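import Literature.MathematicalPhysics.QuantumFieldTheory.Balaban1983to89.B8Prop6DentedCubeMemberGaugedRealGammaGRec
import Literature.MathematicalPhysics.QuantumFieldTheory.Balaban1983to89.B8Prop6DentedCubeMemberGammaPrecompRec

/-!
# `Balaban1983to89.B8Prop6DentedCubeMemberGaugedPrecompRec` — [Balaban1985RegularSpaces] PROPOSITION 6 (1.135)–(1.138) ∕ [Balaban1985Variational] (152)–(153) AT EVERY DENTED
# RECORD CUBE **FOR THE PRE-COMPOSED THEOREM-4 INPUT `(U₀″)^{h}`**: locality of the record averages for `(U₀″)^h` vs `(U₀′)^h`, (1.137)'s identity `Q_k(ηA) = (1∕i) log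
# \overline{(U₀″)^h}ᵏ`, and THE PRE-COMPOSED CROWN BODY from Theorem 4's clauses (the twelve clauses of `Node00.GaugedBoundB8DZ` read at the transformation `h⁻¹·u`, clause 3
# exact for `u`, clause 11 for the pre-composed axial representative) — the pre-composed twins of ✓`…GaugedRec` §1–§2 and ✓`…GaugedRealGammaGRec` §1; item (B′-4)·4 of the
# plan's road (B′) (director-ym №310–№312a branch (ii) case (β); pen dag-n05-e g42)

statement-level skeleton of published theorems with citation tags; proofs where landed; nothing here is a claim about the Yang–Mills mass gap

T. Bałaban, *Spaces of regular gauge field configurations on a lattice and gauge fixing conditions*, Commun. Math. Phys. **99** (1985) 75–102 `[Balaban1985RegularSpaces]`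
("[6]"): Prop. 6 (1.135)–(1.138) p. 99, (1.137) p. 99, (1.134) p. 99, (1.37) p. 82, (1.29) p. 81, (1.62) p. 87, (1.132) p. 99; T. Bałaban, *The variational problem and
background fields in renormalization group method for lattice gauge theories*, CMP **102** (1985) 277–309 `[Balaban1985Variational]` ("[15]"): (152)–(153) p. 301; T. Bałaban,
*Averaging operations for lattice gauge theories*, CMP **98** (1985) 17–51 `[Balaban1985Averaging]` ("[3]"): (8), (11) pp. 18–19, p. 20, p. 24 (sentence after (43)), (87) p. 31,
(127) p. 37; [I] = T. Bałaban, *Renormalization group approach to lattice gauge field theories. I*, CMP **109** (1987) 249–301 `[Balaban1987RG1]`: (0.3)–(0.4), (0.6)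
pp. 252–253.  STATUS: published, refereed.

CITATION HEADER (lean-in-tree rule).  Cell `pub-ymgap` (HUMAN RULING D-0062, Track A), «N05-REC» road, ROAD (B′) = director-ym №310–№312a branch (ii) case (β) («axiality-
preserving block-constant pre-composition of the Theorem-4 input `U₀″ ↦ (U₀″)^h`, `h` constant on the block towers under the dented cells»; licence line: variant, our proof — NOT
a printed clause); LEAD PEN dag-n05-e g42.  WHAT IS REPRODUCED.  §1 `avgIter_precomposed_cutFixed_eq_avgIter_axial` — ✓GaugedRec §1 through `avgIterZ_gaugeAct_units`; §2 ★
`logCovIter_eq_mlog_avgIter_dentedMember_precomposed` — ✓GaugedRec §2 VERBATIM for the datum `(U₀″)^h`, its `Ax` class at the top from (B′-4)·1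
`B8BlockConstantLiftCoverRec.inAxZ_lamST_gaugeAct_of_blockConstant`; §3 ★★ `gaugedBoundB8DZBody_of_clauses_precomposed_mem` — ✓GaugedRealGammaGRec §1 VERBATIM for the datum
`(U₀″)^h` with `α₁′ := 6dL²Mα₀ + ω`, conclusion = the crown's twelve clauses at `h⁻¹·u` (shape (S4) of the cell bus, dag-n05-e g42 STARTED line).  Consumers: F6
`…GaugedRealGammaGPrecompRec` → F7 → F8 of this run; the junction's pre-composed `RecordCrownSU`-type bridge (dag-n07-w3 ∕ dag-n07-e).  Kind «kernel-checked proof», theorems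
only: no `def`, no `instance`, no `notation`, no existing module modified.  `--kind proof --supports stmt-QuantumFields-20541` (K0⁷-keyed, COUNT-NEUTRAL).

HONEST SCOPE.  Bookkeeping; NO new estimate (covariance identities + the record's own (1.137) argument re-run); Theorem 4's clauses are HYPOTHESES here; `HThm4Rec*` CONDITIONAL;
N05 DISCHARGED OF RECORD since R467 (count-neutral record-level work), N07 NOT discharged; counts unmoved (typed 28∕28 · discharged 8∕28); one finite 𝕋⁴ programme at fixed ε,
`G = SU(2)` of record — nothing continuum ∕ ℝ⁴ ∕ OS ∕ mass gap ∕ Clay.  No `sorry`, no `def`.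
-/

noncomputable section

open NormedSpace
open Complex (I)

namespace Literature.MathematicalPhysics.QuantumFieldTheory.Balaban1983to89.B8Prop6DentedCubeMemberGaugedPrecompRec

open MatrixLog B7Prop1Explicit B7Prop2Explicit B7Prop1Local B7AvgGaugeCovariance
open B7Eq92Concrete (mgauge mgauge_one_left)
open B7Prop2Explicit (c2' unitaryUnits)
open B7Prop2Rec (AvgClosedZ C0Z avgClosedZ_unitaryUnits)
open B7Prop3Flat (expCfg c3)
open B7Prop4GeneralLevelsRec (cZ gZ KZ gZ_nonneg)
open B7Prop5Flat (BondIn)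
open BlockAveragingZd (avgIterZ ctrShift)
open B7SectCDGaugeAveragesRec (wrecZ)
open B7SectEFLinearisationRec (logCovIterZ)
open B8Ineq130Rec (tlo thi)
open B8Ineq130 (gaugeAct_one)
open B8Ineq132 (InAk)
open B8Ineq133 (cutCfg_agree)
open B8Ineq133Rec (cutFixedZ avgIterZ_eq_of_agree)
open B8Eq115GaugeFixing (gaugeAct_mul gaugeAct_agree gaugeAct_mem_of)
open B8Eq115GaugeFixingRec (localGaugeZ towerGaugeZ)
open B8Eq119TwistedAxialRec (InAxZ Restr129Z UnderZ)
open B8Eq131DerivationRec (eq87_of_inAxZ_restr129Z)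
open B8Eq146AExpansion (iEta)
open B8Eq184Proof (cfgExp)
open B8Eq140Level (SideTouches sideTouches_of_bondTouches)
open B8Eq138LandauZd (logCfg covLap)
open B8Eq138LandauZdRec (IsLandau138WZ)
open B8Eq131Cubes (tLo tHi ctr)
open B8Eq131CubesRec (bLoZ bHiZ tLo_eq tHi_eq le_of_margin_mono)
open B8Lemma1NonAbelian (mulCfg)
open B8Prop6OfThm4 (const_136)
open B8LeafModelZd3 (mlogCfg mlogCfg_spec)
open B8Prop6CubeMemberEq137Rec (logCovIter_one_eq_mlog_avgIter_loc_of_window inBox_sq_top_of_bond mem_cubeZ_top_of_bondBox under_or_under_of_inBox_bondBoxZ)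
open B8Prop6DentedCubeMemberGammaRec (thm4_hypotheses_one_cutFixed_dented_γ)
open B8Prop6DentedCubeMemberGaugedRec (avgIter_cutFixed_eq_avgIter_axial)
open B8DentedCubeMemberZdRec (lamST_top_apply)
open Node00 (CubeB8DZ GaugedBoundB8DZ)
open B7AvgGaugeCovariance (uLev)
open BlockAveragingZdCovariance (avgIterZ_gaugeAct_units)
open B8BlockConstantLiftCoverRec (inAxZ_lamST_gaugeAct_of_blockConstant)
open B8ScaledSupNorm (bondNorm msup)
open B8Ineq132 (covDerivFwd)
open B8Eq143PlaqExpansion (pdiv)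
open B8Eq146AExpansion (plaqCovDeriv)

export B7Prop1Explicit (Site)

variable {d : ℕ}

/-! ## §1 Locality: `\overline{(U₀″)^h}ᵏ = \overline{(U₀′)^h}ᵏ` on the bonds of `□^{(k)}`, RECORD averages -/

section Locality

variable {𝔸 : Type*} [CStarAlgebra 𝔸]

/-- **`\overline{(U₀″)^h}ᵏ(x, μ) = \overline{(U₀′)^h}ᵏ(x, μ)` ON THE BONDS OF `□^{(k)}`, RECORD AVERAGES** — ✓`B8Prop6DentedCubeMemberGaugedRec.avgIter_cutFixed_eq_avgIter_axial`
(locality (43) of [3]: `U₀″ = U₀′` on the centred `□̃ ⊃ Bᵏ(x) ∪ Bᵏ(x + e_μ)`) transported through the gauge covariance of the (0.4) average, [I] (0.6) ∕ [3] (11):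
`\overline{W^h}ᵏ = h_k · W̄ᵏ · h_k⁻¹` (`BlockAveragingZdCovariance.avgIterZ_gaugeAct_units`).  Needs NO «□ ⊂ Ω_k» (odd `L = 2s+1`).
[cite: Balaban1985RegularSpaces, p.99 («equal to U₀′ on □̃»), (1.137) p.99; Balaban1985Averaging, p.24 (sentence after (43)), (11) p.19; Balaban1987RG1, (0.4) p.253, (0.6) p.253] -/
theorem avgIter_precomposed_cutFixed_eq_avgIter_axial {L s : ℕ} (hLs : L = 2 * s + 1) (k : ℕ) (U₀ : Site d → Fin d → 𝔸ˣ) (a : Site d) {M : ℕ} (ρ : ℕ)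
    (h : Site d → 𝔸ˣ) (x : Site d) (μ : Fin d) (hx : bLoZ L a 0 0 ≤ x) (hx' : x + e μ ≤ bHiZ L a M 0 0) :
    avgIterZ L (gaugeAct h (cutFixedZ L (tLo a ρ) (tHi a M ρ) U₀ k (ctr a M))) k x μ =
      avgIterZ L (gaugeAct h (gaugeAct (localGaugeZ L (tLo a ρ) (tHi a M ρ) U₀ k (ctr a M)) U₀)) k x μ := by
  rw [avgIterZ_gaugeAct_units L h _ k, avgIterZ_gaugeAct_units L h _ k]
  simp only [gaugeAct]
  rw [avgIter_cutFixed_eq_avgIter_axial hLs k U₀ a ρ x μ hx hx']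

end Locality

/-! ## §2 (1.137)'s identity at the dented RECORD member for `(U₀″)^h`, on the bonds of `□^{(k)}` over `Ω_k` -/

section Identity

variable {𝔸 : Type*} [CStarAlgebra 𝔸] [Nontrivial 𝔸]

omit [Nontrivial 𝔸] in
/-- The two exponent-field spellings agree bondwise (private plumbing, as in the original). [folklore] -/
private theorem expCfg_iEta_apply (η : ℝ) (A : Site d → Fin d → 𝔸) (x : Site d) (κ : Fin d) :
    expCfg (iEta η A) x κ = cfgExp η A x κ :=
  congrFun (congrFun (B8Prop3GaugeFixedKLevel.expCfg_iEta_eq_cfgExp η A) x) κ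

/-- ★ (PRE-COMPOSED twin of ✓`B8Prop6DentedCubeMemberGaugedRec.logCovIter_eq_mlog_avgIter_dentedMember`.) **THE IDENTITY OF (1.137) «Q_k(ηA) = (1∕i) log \overline{(U₀″)^h}ᵏ»
AT THE DENTED RECORD MEMBER FOR THE PRE-COMPOSED INPUT, ON THE BONDS OF `□^{(k)}` WHOSE TWO CENTRED `k`-BLOCKS LIE IN `Ω_k`** — clause 11 of the pre-composed crown body (§3).
DATUM: the dented record datum `c`, unitary `U₀ ∈ 𝔄_k({Ω_j}, α₀)` in the (1.130)-regime, `h` CONSTANT `= X(j, y)` on the block tower under every dented cell (so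
(1.132)'s axial class for `U₀″` transports to `(U₀″)^h` at every truncation — (B′-4)·1 `B8BlockConstantLiftCoverRec.inAxZ_lamST_gaugeAct_of_blockConstant`).  ON `u`, `A`:
(1.29)∕(152) `Restr129Z L c.k c.lamS 1 u` (EXACT, the Thm-4 output); `((U₀″)^h)^{u⁻¹} = e^{iηA}` with `|A| ≤ α₂(Lᵏη)⁻¹` on the sides touching `Ω′_k`; the record window
`4·C₁·KZ²·α₂ ≤ 1`, `KZ·α₂ ≤ c₃(d, L)`.  CONCLUSION: for every bond `⟨x, x + e_μ⟩ ⊂ □^{(k)}` with `c.inTop x`, `c.inTop (x + e_μ)`: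
`Q_k(1, iηA)(x, μ) = log \overline{(U₀″)^h}ᵏ(x, μ)`, record averages.  PROOF = the original's verbatim ((87) via `eq87_of_inAxZ_restr129Z`,
`logCovIter_one_eq_mlog_avgIter_loc_of_window`), datum token substituted (item (B′-4)·4 of the plan's road (B′); licence: variant, our proof).
[cite: Balaban1985RegularSpaces, Prop. 6 (1.137) p.99, (1.37) p.82, (1.29) p.81, (1.132) p.99; Balaban1985Variational, (152)–(153) p.301; Balaban1985Averaging, (127) p.37, (87) p.31; Balaban1987RG1, (0.3)–(0.4) pp.252–253, (0.6) p.253] -/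
theorem logCovIter_eq_mlog_avgIter_dentedMember_precomposed (hd2 : 2 ≤ d) {L s : ℕ} (hLs : L = 2 * s + 1) (hs : 1 ≤ s) {K : ℕ} {Ω : ℕ → Set (Site d)}
    (c : CubeB8DZ d L K Ω)
    (U₀ : Site d → Fin d → 𝔸ˣ) (hU₀ : ∀ x κ, U₀ x κ ∈ unitaryUnits 𝔸) {α₀ : ℝ} (hα : 0 < α₀)
    (hα3 : C0Z d * (α₀ * (L : ℝ) ^ 2) ≤ 1 / 3) (hα2 : 2 * (α₀ * (L : ℝ) ^ 2) ≤ c2' d L)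
    {η : ℝ} (hη : 0 < η) (hA : InAk L c.k η α₀ Ω U₀)
    (hsmall : 11 * (d : ℝ) ^ 2 * (L : ℝ) ^ 2 * α₀ + ((c.M : ℝ) + 4 * c.ρ) * d * (L : ℝ) ^ 2 * α₀ ≤ 1 / 6)
    -- the pre-composition `h`: constant `= X(j, y)` on the block tower under every dented cell
    (h : Site d → 𝔸ˣ) (X : ℕ → Site d → 𝔸ˣ)
    (hconst : ∀ j, 1 ≤ j → j ≤ c.k → ∀ y ∈ c.lamS j, ∀ x, UnderZ L j y x → h x = X j y)
    (u : Site d → 𝔸ˣ) (h129 : Restr129Z L c.k c.lamS (1 : Site d → Fin d → 𝔸ˣ) u)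
    (A : Site d → Fin d → 𝔸) {α₂ : ℝ} (hα₂ : 0 ≤ α₂)
    (h4 : 4 * (131072 * ((d : ℝ) + 1) ^ 2) * (KZ d L) ^ 2 * α₂ ≤ 1) (hc₃ : KZ d L * α₂ ≤ c3 d L)
    (h162 : ∀ (z : Site d) (ν : Fin d), SideTouches (c.sq c.k) z ν →
      gaugeAct u⁻¹ (gaugeAct h (cutFixedZ L (tLo c.a c.ρ) (tHi c.a c.M c.ρ) U₀ c.k (ctr c.a c.M))) z ν = cfgExp η A z ν ∧
        ‖A z ν‖ ≤ α₂ * ((L : ℝ) ^ c.k * η)⁻¹)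
    (x : Site d) (μ : Fin d) (hx : bLoZ L c.a 0 0 ≤ x) (hx' : x + e μ ≤ bHiZ L c.a c.M 0 0) (hix : c.inTop x) (hix' : c.inTop (x + e μ)) :
    logCovIterZ L (1 : Site d → Fin d → 𝔸ˣ) (iEta η A) c.k x μ =
      mlog ((avgIterZ L (gaugeAct h (cutFixedZ L (tLo c.a c.ρ) (tHi c.a c.M c.ρ) U₀ c.k (ctr c.a c.M))) c.k x μ : 𝔸ˣ) : 𝔸) := by
  have hL : Odd L := ⟨s, by omega⟩
  have hL1 : 1 ≤ L := by omega
  have hd1 : 1 ≤ d := le_trans (by norm_num) hd2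
  have hG : AvgClosedZ d L (unitaryUnits 𝔸) := avgClosedZ_unitaryUnits d L
  set U₀'' := cutFixedZ L (tLo c.a c.ρ) (tHi c.a c.M c.ρ) U₀ c.k (ctr c.a c.M) with hU₀''
  set U'' := gaugeAct h U₀'' with hU''
  have hgU : gaugeAct u (gaugeAct u⁻¹ U'') = U'' := by rw [← gaugeAct_mul, mul_inv_cancel, gaugeAct_one]
  -- (1.132)'s axial class for `U₀″` on the dented record cells, transported to `(U₀″)^h` ((B′-4)·1), and (87) at the sites of `Λ′_k`
  obtain ⟨-, -, -, hAx₀, -, -⟩ := thm4_hypotheses_one_cutFixed_dented_γ hLs hs hd1 c U₀ hU₀ hα hα3 hα2 hη hA hsmall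
  have hW1 : mulCfg U₀'' (1 : Site d → Fin d → 𝔸ˣ) = U₀'' := mul_one _
  rw [hW1] at hAx₀
  have hAx := inAxZ_lamST_gaugeAct_of_blockConstant hL c h X hconst hAx₀
  have hT : c.lamST c.k = c.lamS := funext fun j => lamST_top_apply c j
  have hAx' : InAxZ L c.k c.lamS (1 : Site d → Fin d → 𝔸ˣ)
      (mgauge (1 : Site d → Fin d → 𝔸ˣ) u (gaugeAct u⁻¹ U'') * (1 : Site d → Fin d → 𝔸ˣ)) := by
    rw [mgauge_one_left, hgU, mul_one, ← hT]
    exact hAx c.k le_rfl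
  have h87 := eq87_of_inAxZ_restr129Z hLs c.k c.lamS (1 : Site d → Fin d → 𝔸ˣ) (gaugeAct u⁻¹ U'') u hAx' h129
  -- both ends are level-`k` DENTED cells: in `□_k^{(k)}` (indeed in `□^{(k)}`) with their centred blocks in `Ω_k`
  obtain ⟨hxΛ, hxΛ'⟩ := inBox_sq_top_of_bond L c.a c.M c.ρ c.k hx hx'
  have hxD : x ∈ c.lamS c.k := (c.mem_lamS_top_iff x).2 ⟨hxΛ, hix⟩
  have hxD' : x + e μ ∈ c.lamS c.k := (c.mem_lamS_top_iff (x + e μ)).2 ⟨hxΛ', hix'⟩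
  have hm := h87 c.k le_rfl x hxD
  have hp := h87 c.k le_rfl (x + e μ) hxD'
  obtain ⟨j, hj⟩ : ∃ j, c.k = j + 1 := ⟨c.k - 1, by have := c.one_le_k; omega⟩
  -- on the centred fine box of the bond: `U₁ = e^{iηA}`, `‖iηA‖ ≤ α₂L^{−k}` (the box lies in `□_k ∩ Ω_k`)
  set b : ℝ := α₂ * ((L : ℝ) ^ c.k)⁻¹ with hb_def
  have hLpos : (0 : ℝ) < L := by exact_mod_cast hL1
  have hb0 : 0 ≤ b := by positivity
  have hLb : (L : ℝ) ^ c.k * b = α₂ := by rw [hb_def]; field_simp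
  haveI : Nontrivial (Fin d) := Fin.nontrivial_iff_two_le.mpr hd2
  have hsqk : ∀ z, InBox (fun i => (L : ℤ) ^ c.k * x i - (ctrShift L c.k : ℤ))
      (fun i => (L : ℤ) ^ c.k * x i + (ctrShift L c.k : ℤ) + if i = μ then (L : ℤ) ^ c.k else 0) z → z ∈ c.sq c.k := by
    intro z hz
    rw [c.sq_top]
    refine ⟨mem_cubeZ_top_of_bondBox hL c.a c.M c.ρ c.k hx hx' hz, ?_⟩
    rcases under_or_under_of_inBox_bondBoxZ hL hz with h | h
    · exact hix z h
    · exact hix' z h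
  have hbox : ∀ z ν, BondIn (fun i => (L : ℤ) ^ c.k * x i - (ctrShift L c.k : ℤ))
      (fun i => (L : ℤ) ^ c.k * x i + (ctrShift L c.k : ℤ) + if i = μ then (L : ℤ) ^ c.k else 0) z ν →
      gaugeAct u⁻¹ U'' z ν = expCfg (iEta η A) z ν ∧ ‖iEta η A z ν‖ ≤ b := by
    intro z ν hz
    obtain ⟨κ, hκ⟩ := exists_ne ν
    obtain ⟨hW, hAz⟩ := h162 z ν (sideTouches_of_bondTouches hκ (Or.inl (hsqk z hz.1)))
    refine ⟨by rw [expCfg_iEta_apply]; exact hW, ?_⟩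
    have hLj : (0 : ℝ) < (L : ℝ) ^ c.k := by positivity
    show ‖((I : ℂ) * η) • A z ν‖ ≤ b
    rw [norm_smul, norm_mul, Complex.norm_I, one_mul, Complex.norm_real, Real.norm_eq_abs, abs_of_pos hη, hb_def]
    calc η * ‖A z ν‖ ≤ η * (α₂ * ((L : ℝ) ^ c.k * η)⁻¹) := mul_le_mul_of_nonneg_left hAz hη.le
      _ = α₂ * ((L : ℝ) ^ c.k)⁻¹ := by field_simp
  have hU₁E : AgreeOn (fun i => (L : ℤ) ^ c.k * x i - (ctrShift L c.k : ℤ))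
      (fun i => (L : ℤ) ^ c.k * x i + (ctrShift L c.k : ℤ) + if i = μ then (L : ℤ) ^ c.k else 0) (gaugeAct u⁻¹ U'') (expCfg (iEta η A)) :=
    fun z ν hz hzν => (hbox z ν ⟨hz, hzν⟩).1
  have hB : ∀ z ν, BondIn (fun i => (L : ℤ) ^ c.k * x i - (ctrShift L c.k : ℤ))
      (fun i => (L : ℤ) ^ c.k * x i + (ctrShift L c.k : ℤ) + if i = μ then (L : ℤ) ^ c.k else 0) z ν → ‖iEta η A z ν‖ ≤ b :=
    fun z ν hz => (hbox z ν hz).2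
  rw [hj] at hU₁E hB hm hp hLb
  have key := logCovIter_one_eq_mlog_avgIter_loc_of_window hLs hs hd1 hG j x μ (iEta η A) hb0 hB (by rw [hLb]; exact h4)
    (by rw [hLb]; exact hc₃) u (gaugeAct u⁻¹ U'') hU₁E hm hp
  rw [hgU] at key
  rw [hj]
  exact key

end Identity

/-! ## §3 Theorem 4's clauses for `(U₀″)^h` ⇒ the pre-composed crown body with `u ∈ G` -/

section Assembly

variable {𝔸 : Type*} [CStarAlgebra 𝔸] [Nontrivial 𝔸]
set_option maxHeartbeats 400000 in
/-- ★★ (PRE-COMPOSED twin of ✓`B8Prop6DentedCubeMemberGaugedRealGammaGRec.gaugedBoundB8DZBody_of_clauses_mem`.) **(1.135)–(1.138) ∕ (152)–(153) AT EVERY DENTED RECORD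
CUBE FOR THE PRE-COMPOSED THEOREM-4 INPUT `(U₀″)^{h}`, FROM A `G`-VALUED GAUGE TRANSFORMATION WITH THEOREM 4's CLAUSES — THE PRE-COMPOSED CROWN BODY** (bookkeeping engine):
the original VERBATIM (datum regime, the record's Prop-4 window `4C₁KZ²α₂ ≤ 1`, `KZ·α₂ ≤ c₃` at `α₂ = 5dLB₀(L³α₀ + (6dL²Mα₀ + ω))`, (1.137)'s identity on the `Ω_k`-bonds of
`□^{(k)}` by §2 + §1 at `A := mlogCfg …`, the (1.62) constant weakened to `5dLB₀·(7dL²Mα₀ + ω)` by `const_136`) for the datum `(U₀″)^h` (`h` `G`-valued, constant `= X(j,y)`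
on the block tower under every dented cell, `0 ≤ ω`), and the CONCLUSION = `Node00.GaugedBoundB8DZ`'s twelve clauses READ AT THE TRANSFORMATION `h⁻¹·u`
(`c.fixed U₀ (h⁻¹*u) = ((U₀″)^h)^{u⁻¹}`, `c.expo η U₀ (h⁻¹*u)`, `w′ = (c.vfix U₀)⁻¹*(h⁻¹*u) ∈ G`, (1.135)′ `U₀^{w′⁻¹} = ((U₀″)^h)^{u⁻¹}` on `□̃`) EXCEPT clause 3, which is
(1.29)∕(152) EXACT for the Theorem-4 output `u` (`Restr129Z L c.k c.lamS 1 u`; `h⁻¹u` itself carries the cell data `X⁻¹`, (B′-1) `B8BlockConstantLiftRec`), and clause 11, which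
reads `Q_k(1, iηA) = log \overline{(U₀^{v})^{h}}ᵏ` — (1.137) for the pre-composed axial representative `gaugeAct h (c.axial U₀)` ([I] (0.6)).  Memberships `u ∈ G`, `w′ ∈ G`.
Item (B′-4)·4 of the plan's road (B′) (director-ym №310–№312a branch (ii) case (β); licence: variant, our proof).
[cite: Balaban1985RegularSpaces, Prop. 6 (1.135)–(1.138) p.99, (1.137) p.99, (1.134) p.99, (1.62) p.87, (1.29) p.81; Balaban1985Variational, (152)–(153) p.301; Balaban1985Averaging, p.20, (11) p.19; Balaban1987RG1, (0.3)–(0.4) pp.252–253, (0.6) p.253] -/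
theorem gaugedBoundB8DZBody_of_clauses_precomposed_mem (hd2 : 2 ≤ d) {L s : ℕ} (hLs : L = 2 * s + 1) (hs : 1 ≤ s) {G : Subgroup 𝔸ˣ} (hGu : G ≤ unitaryUnits 𝔸)
    {B₀ : ℝ} (hB₀ : 0 < B₀) {η : ℝ} (hη : 0 < η) {K : ℕ}
    {Ω : ℕ → Set (Site d)} (c : CubeB8DZ d L K Ω) (U₀ : Site d → Fin d → 𝔸ˣ) (hU₀ : ∀ x κ, U₀ x κ ∈ unitaryUnits 𝔸) {α₀ : ℝ} (hα : 0 < α₀)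
    (hA : InAk L c.k η α₀ Ω U₀) (hα3 : C0Z d * (α₀ * (L : ℝ) ^ 2) ≤ 1 / 3) (hα2 : 2 * (α₀ * (L : ℝ) ^ 2) ≤ c2' d L)
    (hsmall : 11 * (d : ℝ) ^ 2 * (L : ℝ) ^ 2 * α₀ + ((c.M : ℝ) + 4 * c.ρ) * d * (L : ℝ) ^ 2 * α₀ ≤ 1 / 6)
    -- the pre-composition `h`: `G`-valued, constant `= X(j, y)` on the block tower under every dented cell; the oscillation letter `ω ≥ 0`
    (h : Site d → 𝔸ˣ) (hhG : ∀ x, h x ∈ G) (X : ℕ → Site d → 𝔸ˣ)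
    (hconst : ∀ j, 1 ≤ j → j ≤ c.k → ∀ y ∈ c.lamS j, ∀ x, UnderZ L j y x → h x = X j y) {ω : ℝ} (hω : 0 ≤ ω)
    (h4C : 4 * (131072 * ((d : ℝ) + 1) ^ 2) * (KZ d L) ^ 2 * (5 * (d : ℝ) * L * B₀ * ((L : ℝ) ^ 3 * α₀ + (6 * d * (L : ℝ) ^ 2 * c.M * α₀ + ω))) ≤ 1)
    (hc3α : KZ d L * (5 * (d : ℝ) * L * B₀ * ((L : ℝ) ^ 3 * α₀ + (6 * d * (L : ℝ) ^ 2 * c.M * α₀ + ω))) ≤ c3 d L)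
    (u : Site d → 𝔸ˣ) (huG : ∀ x, u x ∈ G) (huS : ∀ x, x ∉ c.sq 0 → u x = 1)
    (h129 : Restr129Z L c.k c.lamS (1 : Site d → Fin d → 𝔸ˣ) u)
    (hLan : IsLandau138WZ L c.k η (c.sq 0) c.lamS (1 : Site d → Fin d → 𝔸ˣ)
      (gaugeAct u⁻¹ (gaugeAct h (cutFixedZ L (tLo c.a c.ρ) (tHi c.a c.M c.ρ) U₀ c.k (ctr c.a c.M)))))
    (h162 : ∀ j, j ≤ c.k → ∀ b ∈ {b : Site d × Fin d | SideTouches (c.sq j) b.1 b.2},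
      gaugeAct u⁻¹ (gaugeAct h (cutFixedZ L (tLo c.a c.ρ) (tHi c.a c.M c.ρ) U₀ c.k (ctr c.a c.M))) b.1 b.2 =
          cfgExp η (logCfg η (gaugeAct u⁻¹ (gaugeAct h (cutFixedZ L (tLo c.a c.ρ) (tHi c.a c.M c.ρ) U₀ c.k (ctr c.a c.M))))) b.1 b.2 ∧
        IsSelfAdjoint (logCfg η (gaugeAct u⁻¹ (gaugeAct h (cutFixedZ L (tLo c.a c.ρ) (tHi c.a c.M c.ρ) U₀ c.k (ctr c.a c.M)))) b.1 b.2) ∧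
        ‖logCfg η (gaugeAct u⁻¹ (gaugeAct h (cutFixedZ L (tLo c.a c.ρ) (tHi c.a c.M c.ρ) U₀ c.k (ctr c.a c.M)))) b.1 b.2‖ ≤
          (5 * (d : ℝ) * L * B₀ * ((L : ℝ) ^ 3 * α₀ + (6 * d * (L : ℝ) ^ 2 * c.M * α₀ + ω))) * ((L : ℝ) ^ j * η)⁻¹)
    (hwG : ∀ x, ((localGaugeZ L (tLo c.a c.ρ) (tHi c.a c.M c.ρ) U₀ c.k (ctr c.a c.M))⁻¹ * (h⁻¹ * u)) x ∈ G)
    (h135 : AgreeOn (tlo L (tLo c.a c.ρ) c.k) (thi L (tHi c.a c.M c.ρ) c.k)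
      (gaugeAct ((localGaugeZ L (tLo c.a c.ρ) (tHi c.a c.M c.ρ) U₀ c.k (ctr c.a c.M))⁻¹ * (h⁻¹ * u))⁻¹ U₀)
      (gaugeAct u⁻¹ (gaugeAct h (cutFixedZ L (tLo c.a c.ρ) (tHi c.a c.M c.ρ) U₀ c.k (ctr c.a c.M)))))
    (h136₂ : B8ScaledSupNorm.msup L c.k η (-(2 : ℝ)) (fun j (t : Fin d × Fin d × Site d) => SideTouches (c.sq j) t.2.2 t.2.1)
      (fun t => B8Ineq132.covDerivFwd η (1 : Site d → Fin d → 𝔸ˣ) t.1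
        (fun z => mlogCfg c.k η c.sq (gaugeAct u⁻¹ (gaugeAct h (cutFixedZ L (tLo c.a c.ρ) (tHi c.a c.M c.ρ) U₀ c.k (ctr c.a c.M)))) z t.2.1)
        t.2.2) ≤ 5 * (d : ℝ) * L * B₀ * (7 * d * (L : ℝ) ^ 2 * c.M * α₀ + ω))
    (h136₃ : B8ScaledSupNorm.bondNorm L c.k η (-(3 : ℝ)) c.sq
      (fun x μ => B8Eq143PlaqExpansion.pdiv η (1 : Site d → Fin d → 𝔸ˣ) (B8Eq146AExpansion.plaqCovDeriv η (1 : Site d → Fin d → 𝔸ˣ)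
        (mlogCfg c.k η c.sq (gaugeAct u⁻¹ (gaugeAct h (cutFixedZ L (tLo c.a c.ρ) (tHi c.a c.M c.ρ) U₀ c.k (ctr c.a c.M)))))) μ x)
        ≤ 5 * (d : ℝ) * L * B₀ * (7 * d * (L : ℝ) ^ 2 * c.M * α₀ + ω))
    (h136₄ : B8ScaledSupNorm.bondNorm L c.k η (-(3 : ℝ)) c.sq
      (fun x μ => covLap η (1 : Site d → Fin d → 𝔸ˣ)
        (fun z => mlogCfg c.k η c.sq (gaugeAct u⁻¹ (gaugeAct h (cutFixedZ L (tLo c.a c.ρ) (tHi c.a c.M c.ρ) U₀ c.k (ctr c.a c.M)))) z μ) x)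
        ≤ 5 * (d : ℝ) * L * B₀ * (7 * d * (L : ℝ) ^ 2 * c.M * α₀ + ω)) :
      ∃ u : Site d → 𝔸ˣ, (∀ x, u x ∈ G) ∧ (∀ x, x ∉ c.sq 0 → u x = 1) ∧
        Restr129Z L c.k c.lamS (1 : Site d → Fin d → 𝔸ˣ) u ∧
        IsLandau138WZ L c.k η (c.sq 0) c.lamS (1 : Site d → Fin d → 𝔸ˣ) (c.fixed U₀ (h⁻¹ * u)) ∧
        (∀ j, j ≤ c.k → ∀ b ∈ {b : Site d × Fin d | SideTouches (c.sq j) b.1 b.2},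
          c.fixed U₀ (h⁻¹ * u) b.1 b.2 = cfgExp η (logCfg η (c.fixed U₀ (h⁻¹ * u))) b.1 b.2 ∧ IsSelfAdjoint (logCfg η (c.fixed U₀ (h⁻¹ * u)) b.1 b.2) ∧
            ‖logCfg η (c.fixed U₀ (h⁻¹ * u)) b.1 b.2‖ ≤ (5 * (d : ℝ) * L * B₀ * (7 * d * (L : ℝ) ^ 2 * c.M * α₀ + ω)) * ((L : ℝ) ^ j * η)⁻¹) ∧
        (∀ x, ((c.vfix U₀)⁻¹ * (h⁻¹ * u)) x ∈ G) ∧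
        AgreeOn (tlo L (tLo c.a c.ρ) c.k) (thi L (tHi c.a c.M c.ρ) c.k) (gaugeAct ((c.vfix U₀)⁻¹ * (h⁻¹ * u))⁻¹ U₀) (c.fixed U₀ (h⁻¹ * u)) ∧
        msup L c.k η (-(2 : ℝ)) (fun j (t : Fin d × Fin d × Site d) => SideTouches (c.sq j) t.2.2 t.2.1)
            (fun t => covDerivFwd η (1 : Site d → Fin d → 𝔸ˣ) t.1 (fun z => c.expo η U₀ (h⁻¹ * u) z t.2.1) t.2.2) ≤ (5 * (d : ℝ) * L * B₀ * (7 * d * (L : ℝ) ^ 2 * c.M * α₀ + ω)) ∧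
        bondNorm L c.k η (-(3 : ℝ)) c.sq
            (fun x μ => pdiv η (1 : Site d → Fin d → 𝔸ˣ) (plaqCovDeriv η (1 : Site d → Fin d → 𝔸ˣ) (c.expo η U₀ (h⁻¹ * u))) μ x) ≤ (5 * (d : ℝ) * L * B₀ * (7 * d * (L : ℝ) ^ 2 * c.M * α₀ + ω)) ∧
        bondNorm L c.k η (-(3 : ℝ)) c.sq (fun x μ => covLap η (1 : Site d → Fin d → 𝔸ˣ) (fun z => c.expo η U₀ (h⁻¹ * u) z μ) x) ≤ (5 * (d : ℝ) * L * B₀ * (7 * d * (L : ℝ) ^ 2 * c.M * α₀ + ω)) ∧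
        (∀ (x : Site d) (μ : Fin d), bLoZ L c.a 0 0 ≤ x → x + e μ ≤ bHiZ L c.a c.M 0 0 → c.inTop x → c.inTop (x + e μ) →
          logCovIterZ L (1 : Site d → Fin d → 𝔸ˣ) (iEta η (c.expo η U₀ (h⁻¹ * u))) c.k x μ = mlog ((avgIterZ L (gaugeAct h (c.axial U₀)) c.k x μ : 𝔸ˣ) : 𝔸)) := by
  have hu : ∀ x, u x ∈ unitaryUnits 𝔸 := fun x => hGu (huG x)
  have hh : ∀ x, h x ∈ unitaryUnits 𝔸 := fun x => hGu (hhG x)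
  have hL1 : 1 ≤ L := by omega
  have hd1 : 1 ≤ d := le_trans (by norm_num) hd2
  have hLpos : (0 : ℝ) < L := by exact_mod_cast hL1
  have hdpos : (0 : ℝ) < d := by exact_mod_cast hd1
  have hρ : 1 ≤ c.ρ := hL1.trans c.L_le_ρ
  have hM1 : 1 ≤ c.M := hρ.trans c.ρ_le_M
  have hMpos : (0 : ℝ) < c.M := by exact_mod_cast hM1
  have hLdM : (L : ℝ) ≤ d * c.M := by exact_mod_cast c.L_le_dM
  have hB0 : 0 < 5 * (d : ℝ) * L * B₀ := by positivity
  -- print's constant for the pre-composed input: `5dLB₀·(L³α₀ + (6dL²Mα₀ + ω)) ≤ 5dLB₀·(7dL²Mα₀ + ω)` (`const_136` + `ω`)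
  have hconstω : 5 * (d : ℝ) * L * B₀ * ((L : ℝ) ^ 3 * α₀ + (6 * d * (L : ℝ) ^ 2 * c.M * α₀ + ω)) ≤ 5 * (d : ℝ) * L * B₀ * (7 * d * (L : ℝ) ^ 2 * c.M * α₀ + ω) := by
    have h0 := const_136 hLpos hα hB0.le hLdM (M := (c.M : ℝ))
    nlinarith [h0, hB0.le, hω]
  set α₂ : ℝ := 5 * (d : ℝ) * L * B₀ * ((L : ℝ) ^ 3 * α₀ + (6 * d * (L : ℝ) ^ 2 * c.M * α₀ + ω)) with hα₂_def
  have hα₂0 : 0 ≤ α₂ := by positivity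
  have h16 : 16 * α₂ ≤ 1 := by
    have hC1 : (1 : ℝ) ≤ 131072 * ((d : ℝ) + 1) ^ 2 := by nlinarith [sq_nonneg ((d : ℝ) + 1), hdpos]
    have hK2 : (2 : ℝ) ≤ KZ d L := by unfold KZ; have := gZ_nonneg d L; linarith
    have hK4 : (4 : ℝ) ≤ (KZ d L) ^ 2 := by nlinarith
    have h1 : (16 : ℝ) ≤ 4 * (131072 * ((d : ℝ) + 1) ^ 2) * (KZ d L) ^ 2 := by nlinarith
    have : 16 * α₂ ≤ 4 * (131072 * ((d : ℝ) + 1) ^ 2) * (KZ d L) ^ 2 * α₂ := mul_le_mul_of_nonneg_right h1 hα₂0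
    exact this.trans h4C
  set U₀'' := cutFixedZ L (tLo c.a c.ρ) (tHi c.a c.M c.ρ) U₀ c.k (ctr c.a c.M) with hU₀''
  set U'' := gaugeAct h U₀'' with hU''
  obtain ⟨hmem₀, -, -, -, -, -⟩ := thm4_hypotheses_one_cutFixed_dented_γ hLs hs hd1 c U₀ hU₀ hα hα3 hα2 hη hA hsmall
  have hmem : ∀ x κ, U'' x κ ∈ unitaryUnits 𝔸 := gaugeAct_mem_of hmem₀ hh
  have hU₁u : ∀ x κ, gaugeAct u⁻¹ U'' x κ ∈ unitaryUnits 𝔸 := gaugeAct_mem_of hmem fun x => (unitaryUnits 𝔸).inv_mem (hu x)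
  obtain ⟨-, hrep, -⟩ := mlogCfg_spec hη hL1 c.k (1 : Site d → Fin d → 𝔸ˣ) hU₁u hα₂0 h16 c.sq
    (fun j hj y τ hsd => ⟨(h162 j hj (y, τ) hsd).1, (h162 j hj (y, τ) hsd).2.2⟩)
  have h162k : ∀ (z : Site d) (ν : Fin d), SideTouches (c.sq c.k) z ν →
      gaugeAct u⁻¹ U'' z ν = cfgExp η (mlogCfg c.k η c.sq (gaugeAct u⁻¹ U'')) z ν ∧
        ‖mlogCfg c.k η c.sq (gaugeAct u⁻¹ U'') z ν‖ ≤ α₂ * ((L : ℝ) ^ c.k * η)⁻¹ := fun z ν hsd =>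
    ⟨(hrep c.k le_rfl z ν hsd).2, by rw [(hrep c.k le_rfl z ν hsd).1]; exact (h162 c.k le_rfl (z, ν) hsd).2.2⟩
  have h137 : ∀ (x : Site d) (μ : Fin d), bLoZ L c.a 0 0 ≤ x → x + e μ ≤ bHiZ L c.a c.M 0 0 → c.inTop x → c.inTop (x + e μ) →
      logCovIterZ L (1 : Site d → Fin d → 𝔸ˣ)
          (iEta η (mlogCfg c.k η c.sq (gaugeAct u⁻¹ U''))) c.k x μ =
        mlog ((avgIterZ L (gaugeAct h (gaugeAct (localGaugeZ L (tLo c.a c.ρ) (tHi c.a c.M c.ρ) U₀ c.k (ctr c.a c.M)) U₀)) c.k x μ : 𝔸ˣ) : 𝔸) := by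
    intro x μ hx hx' hix hix'
    rw [← avgIter_precomposed_cutFixed_eq_avgIter_axial hLs c.k U₀ c.a c.ρ h x μ hx hx']
    exact logCovIter_eq_mlog_avgIter_dentedMember_precomposed hd2 hLs hs c U₀ hU₀ hα hα3 hα2 hη hA hsmall h X hconst u h129 _ hα₂0 h4C hc3α
      h162k x μ hx hx' hix hix'
  have h162' : ∀ j, j ≤ c.k → ∀ b ∈ {b : Site d × Fin d | SideTouches (c.sq j) b.1 b.2},
      gaugeAct u⁻¹ U'' b.1 b.2 = cfgExp η (logCfg η (gaugeAct u⁻¹ U'')) b.1 b.2 ∧ IsSelfAdjoint (logCfg η (gaugeAct u⁻¹ U'') b.1 b.2) ∧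
        ‖logCfg η (gaugeAct u⁻¹ U'') b.1 b.2‖ ≤ (5 * (d : ℝ) * L * B₀ * (7 * d * (L : ℝ) ^ 2 * c.M * α₀ + ω)) * ((L : ℝ) ^ j * η)⁻¹ := by
    intro j hj b hb
    obtain ⟨h1, h2, h3⟩ := h162 j hj b hb
    refine ⟨h1, h2, h3.trans ?_⟩
    have hη0 : 0 ≤ ((L : ℝ) ^ j * η)⁻¹ := by positivity
    exact mul_le_mul_of_nonneg_right hconstω hη0
  -- the crown body at the transformation `h⁻¹·u`: `c.fixed U₀ (h⁻¹u) = ((U₀″)^h)^{u⁻¹}` ([I] (0.6): `(h⁻¹u)⁻¹ = u⁻¹h`)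
  have efix : c.fixed U₀ (h⁻¹ * u) = gaugeAct u⁻¹ U'' := by
    show gaugeAct (h⁻¹ * u)⁻¹ U₀'' = gaugeAct u⁻¹ (gaugeAct h U₀'')
    rw [mul_inv_rev, inv_inv, gaugeAct_mul]
  have eexpo : c.expo η U₀ (h⁻¹ * u) = mlogCfg c.k η c.sq (gaugeAct u⁻¹ U'') := by
    show mlogCfg c.k η c.sq (c.fixed U₀ (h⁻¹ * u)) = _
    rw [efix]
  refine ⟨u, huG, huS, h129, ?_, ?_, hwG, ?_, ?_, ?_, ?_, ?_⟩
  · rw [efix]; exact hLan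
  · intro j hj b hb; rw [efix]; exact h162' j hj b hb
  · rw [efix]; exact h135
  · rw [eexpo]; exact h136₂
  · rw [eexpo]; exact h136₃
  · rw [eexpo]; exact h136₄
  · intro x μ hx hx' hix hix'; rw [eexpo]; exact h137 x μ hx hx' hix hix'

end Assembly

#print axioms avgIter_precomposed_cutFixed_eq_avgIter_axial
#print axioms logCovIter_eq_mlog_avgIter_dentedMember_precomposed
#print axioms gaugedBoundB8DZBody_of_clauses_precomposed_mem

end Literature.MathematicalPhysics.QuantumFieldTheory.Balaban1983to89.B8Prop6DentedCubeMemberGaugedPrecompRec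

end
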